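import Literature.Barriers.MatrixMultiplication.QuasirandomBarrierProofs
import HarnessLib

/-!
# The quasirandomness barrier for simultaneous triple product constructions

Topic `Literature/Barriers/MatrixMultiplication`. Blasiak–Cohn–Grochow–Pratt–Umans 2023 state and
prove their representation-theoretic barrier (Thm. 3.2, the tree's `BCGPU2023_thm32`, proved in
`QuasirandomBarrierProofs.lean`) for a single triple `S, T, U` with the triple product property.
This file records that **the printed Fourier-analytic proof extends verbatim to STPP families**
(Cohn–Kleinberg–Szegedy–Umans 2005, Def. 5.1, the tree's `SimultaneousTPP`) in *perfect* groups:

* `BCGPU2023_thm32_stpp` — if `G` is a finite perfect group (`commutator G = ⊤`) and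
  `(Aᵢ, Bᵢ, Cᵢ)_{i ∈ ι}` satisfy the STPP with all sets non-empty, then with
  `P_AB = ∑ |Aᵢ||Bᵢ|`, `P_BC = ∑ |Bᵢ||Cᵢ|`, `P_CA = ∑ |Cᵢ||Aᵢ|` and `N = ∑ |Aᵢ||Bᵢ||Cᵢ|`,
  `P_AB P_BC P_CA ≤ |G| N + |G|^{3/2} (P_AB P_BC P_CA)^{1/2} / n(G)^{1/2}`
  (`n(G) = secondCharDegree G`). For a single triple `P_AB P_BC P_CA = N²` and this is Thm. 3.2.
* `BCGPU2023_thm32_stpp.dichotomy` — hence `P_AB P_BC P_CA ≤ 2|G| N` or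
  `P_AB P_BC P_CA ≤ 4 |G|³ / n(G)`;
* `BCGPU2023_thm32_stpp.packing` — with `N⁶ ≤ |G|³ (P_AB P_BC P_CA)²` (pairwise packing and
  Cauchy–Schwarz, `stpp_sum_card_pow_six_le`): `(P_AB P_BC P_CA)⁴ ≤ 64 |G|⁹` or
  `P_AB P_BC P_CA ≤ 4|G|³/n(G)`;
* `BCGPU2023_thm32_stpp.sum_rpow_two_thirds_le` — the STPP form of Cor. 3.3:
  `∑ᵢ (|Aᵢ||Bᵢ||Cᵢ|)^{2/3} ≤ max (√2 |G|^{3/4}) (4^{1/3} |G| / n(G)^{1/3})` (Hölder,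
  `sum_rpow_third_mul_le`), to be compared with the STPP packing bound
  `∑ᵢ (|Aᵢ||Bᵢ||Cᵢ|)^{2/3} ≥ |G|^{1−o(1)}` that `ω = 2` via CKSU 2005 Thm. 5.5 requires; so no family
  of perfect groups with `n(G) ≥ Ω(|G|^δ)` gives `ω = 2` through STPP constructions either.

Why perfect: in the single-triple proof every one-dimensional representation `π` contributes
`|π(S)|²|π(T)|²|π(U)|² ≥ 0` and is discarded; for a family the one-dimensional contribution is a
product of three complex numbers without sign, so the argument needs that the trivial character is
the only linear character (`block_eq_one_of_dim_one`). The counting inputs are the STPP analogues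
(`stpp_coeff_one_six`, `stpp_coeff_one_four`) of the tree's `TripleProductProperty.coeff_one_six` /
`coeff_one_four`: with `X = ∑ⱼ 𝟙_{Aⱼ⁻¹}𝟙_{Bⱼ}`, `Y = ∑ₖ 𝟙_{Bₖ⁻¹}𝟙_{Cₖ}`, `Z = ∑ᵢ 𝟙_{Cᵢ⁻¹}𝟙_{Aᵢ}`,
clause (ii) of CKSU Def. 5.1 (pattern `aᵢ a'ⱼ⁻¹ bⱼ b'ₖ⁻¹ cₖ c'ᵢ⁻¹`) gives `(XYZ)(1) = N`, and with
indices `(j, k, j)` and `c = c' ∈ Cⱼ ≠ ∅` it gives `(X^*X)(1) = P_AB` (the input of Parseval).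

This is an audit note (barrier audit of `QuasirandomBarrier.lean`, D-0021): the catalogue entry's
scope caveat (a) "single TPP triples (not simultaneous/STPP constructions)" describes the PRINTED
scope; mathematically the barrier also covers STPP constructions in perfect groups with large
`n(G)` (e.g. `SL(n,q)`, simple groups of Lie type of bounded rank), by the theorems below.
Remarks (not formalised): (1) for `G` with `|G : G'| = m`, an STPP family in `G` yields one in the
perfect group `G'` losing a factor `≤ m⁴` in `∑(|Aᵢ||Bᵢ||Cᵢ|)^{2/3}` (the STPP is invariant under
`(Aᵢ, Bᵢ, Cᵢ) ↦ (xᵢAᵢ, xᵢBᵢ, xᵢCᵢ)` and under common right translations of all `Aᵢ`, of all `Bᵢ`,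
of all `Cᵢ`; pigeonhole over cosets), and `G'` has no non-trivial irreducible representation of
dimension `< n(G)/m`; so the conclusion persists when `|G : G'| = |G|^{o(1)}`; (2) it does NOT
persist by this method when `G` has `|G|^{Ω(1)}` linear characters (e.g. `GL(2,q)`,
`𝔽_q^× × SL(2,q)`), where the linear characters can cancel the main term — these are the
"direct product" escapes of the printed barrier (BCGPU 2023, §1.1, p. 4).

## References

* J. Blasiak, H. Cohn, J. A. Grochow, K. Pratt, C. Umans, *Matrix multiplication via matrix
  groups*, ITCS 2023, LIPIcs 251, 19:1–19:16, arXiv:2204.03826, Thm. 3.2 and its proof (p. 6 of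
  the held text `paper:arxiv-2204.03826`). [BlasiakCohnGrochowPrattUmans2023]
* H. Cohn, R. Kleinberg, B. Szegedy, C. Umans, *Group-theoretic algorithms for matrix
  multiplication*, FOCS 2005, Def. 5.1 (STPP). [CohnKleinbergSzegedyUmans2005]
-/

noncomputable section

open scoped BigOperators Matrix ComplexOrder

namespace Literature.Barriers.MatrixMultiplication

open Literature.RepresentationTheory.FiniteGroups Literature.Combinatorics.Additive

/-! ## Counting solutions under the STPP -/

section Count

variable {G : Type*} [Group G] {R : Type*} [Semiring R]
variable {ι : Type*} {A B C : ι → Finset G}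

/-- The STPP (CKSU 2005, Def. 5.1) is invariant under the cyclic rotation `(A, B, C) ↦ (B, C, A)`
(conjugate the six-fold product by `a a'⁻¹`). [cite: CohnKleinbergSzegedyUmans2005, Def. 5.1] -/
theorem simultaneousTPP_rotate (h : SimultaneousTPP A B C) : SimultaneousTPP B C A := by
  refine ⟨fun i => (h.1 i).rotate, fun i j l b hb b' hb' c hc c' hc' a ha a' ha' heq => ?_⟩
  have heq' : a * a'⁻¹ * b * b'⁻¹ * c * c'⁻¹ = 1 :=
    calc a * a'⁻¹ * b * b'⁻¹ * c * c'⁻¹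
        = a * a'⁻¹ * (b * b'⁻¹ * c * c'⁻¹ * a * a'⁻¹) * (a * a'⁻¹)⁻¹ := by group
      _ = 1 := by rw [heq]; group
  obtain ⟨hli, hij⟩ := h.2 l i j a ha a' ha' b hb b' hb' c hc c' hc' heq'
  subst hli hij
  exact ⟨rfl, rfl⟩

variable [DecidableEq G]

/-- The coefficient at `1` of `𝟙_{S₁⁻¹}𝟙_{S₂} · 𝟙_{S₃⁻¹}𝟙_{S₄} · 𝟙_{S₅⁻¹}𝟙_{S₆}` counts the solutions of
`s₁⁻¹ s₂ (s₃⁻¹ s₄) (s₅⁻¹ s₆) = 1`. [folklore] -/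
theorem coeff_one_six_eq_card_filter (S₁ S₂ S₃ S₄ S₅ S₆ : Finset G) :
    ((indicatorElemInv R S₁ * indicatorElem R S₂) * (indicatorElemInv R S₃ * indicatorElem R S₄) *
        (indicatorElemInv R S₅ * indicatorElem R S₆)).coeff 1 =
      (((((S₁ ×ˢ S₂) ×ˢ (S₃ ×ˢ S₄)) ×ˢ (S₅ ×ˢ S₆)).filter
        fun y : ((G × G) × (G × G)) × (G × G) =>
          y.1.1.1⁻¹ * y.1.1.2 * (y.1.2.1⁻¹ * y.1.2.2) * (y.2.1⁻¹ * y.2.2) = 1).card : R) := by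
  rw [indicatorElemInv_def, indicatorElem_def, indicatorElemInv_def, indicatorElem_def,
    indicatorElemInv_def, indicatorElem_def, sum_single_mul_sum_single,
    sum_single_mul_sum_single, sum_single_mul_sum_single, sum_single_mul_sum_single,
    sum_single_mul_sum_single, coeff_one_sum_single]

/-- The coefficient at `1` of `𝟙_{S₁⁻¹}𝟙_{S₂} · 𝟙_{S₃⁻¹}𝟙_{S₄}` counts the solutions of
`s₁⁻¹ s₂ (s₃⁻¹ s₄) = 1`. [folklore] -/
theorem coeff_one_four_eq_card_filter (S₁ S₂ S₃ S₄ : Finset G) :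
    ((indicatorElemInv R S₁ * indicatorElem R S₂) *
        (indicatorElemInv R S₃ * indicatorElem R S₄)).coeff 1 =
      ((((S₁ ×ˢ S₂) ×ˢ (S₃ ×ˢ S₄)).filter fun y : (G × G) × (G × G) =>
        y.1.1⁻¹ * y.1.2 * (y.2.1⁻¹ * y.2.2) = 1).card : R) := by
  rw [indicatorElemInv_def, indicatorElem_def, indicatorElemInv_def, indicatorElem_def,
    sum_single_mul_sum_single, sum_single_mul_sum_single, sum_single_mul_sum_single,
    coeff_one_sum_single]

/-- Clause (ii) of the STPP: the word `a'ⱼ⁻¹ bⱼ · b'ₗ⁻¹ cₗ · c'ᵢ⁻¹ aᵢ = 1` has no solution unless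
`i = j = l` (conjugating by `aᵢ` gives CKSU's pattern `aᵢ a'ⱼ⁻¹ bⱼ b'ₗ⁻¹ cₗ c'ᵢ⁻¹ = 1`).
[cite: CohnKleinbergSzegedyUmans2005, Def. 5.1] -/
theorem stpp_filter_six_eq_empty (h : SimultaneousTPP A B C) {i j l : ι}
    (hne : ¬ (i = j ∧ j = l)) :
    ((((A j ×ˢ B j) ×ˢ (B l ×ˢ C l)) ×ˢ (C i ×ˢ A i)).filter
        fun y : ((G × G) × (G × G)) × (G × G) =>
          y.1.1.1⁻¹ * y.1.1.2 * (y.1.2.1⁻¹ * y.1.2.2) * (y.2.1⁻¹ * y.2.2) = 1) = ∅ := by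
  refine Finset.filter_eq_empty_iff.2 ?_
  rintro ⟨⟨⟨a', b⟩, ⟨b', c⟩⟩, ⟨c', a⟩⟩ hy heq
  simp only [Finset.mem_product] at hy
  dsimp only at heq
  obtain ⟨⟨⟨ha', hb⟩, hb', hc⟩, hc', ha⟩ := hy
  have heq' : a * a'⁻¹ * b * b'⁻¹ * c * c'⁻¹ = 1 :=
    calc a * a'⁻¹ * b * b'⁻¹ * c * c'⁻¹ = a * (a'⁻¹ * b * (b'⁻¹ * c) * (c'⁻¹ * a)) * a⁻¹ := by group
      _ = 1 := by rw [heq]; group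
  exact hne (h.2 i j l a ha a' ha' b hb b' hb' c hc c' hc' heq')

/-- Clause (ii) of the STPP with indices `(j, l, j)` and `c = c' ∈ Cⱼ`: the word
`bⱼ⁻¹ aⱼ · a'ₗ⁻¹ b'ₗ = 1` has no solution with `j ≠ l` (the sets `Aⱼ⁻¹Bⱼ` are pairwise disjoint;
needs `Cⱼ ≠ ∅`). [cite: CohnKleinbergSzegedyUmans2005, Def. 5.1] -/
theorem stpp_filter_four_eq_empty (h : SimultaneousTPP A B C) (hC : ∀ i, (C i).Nonempty)
    {j l : ι} (hne : j ≠ l) :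
    (((B j ×ˢ A j) ×ˢ (A l ×ˢ B l)).filter fun y : (G × G) × (G × G) =>
        y.1.1⁻¹ * y.1.2 * (y.2.1⁻¹ * y.2.2) = 1) = ∅ := by
  refine Finset.filter_eq_empty_iff.2 ?_
  rintro ⟨⟨b, a⟩, ⟨a', b'⟩⟩ hy heq
  simp only [Finset.mem_product] at hy
  dsimp only at heq
  obtain ⟨⟨hb, ha⟩, ha', hb'⟩ := hy
  obtain ⟨c, hc⟩ := hC j
  have heq' : a * a'⁻¹ * b' * b⁻¹ * c * c⁻¹ = 1 :=
    calc a * a'⁻¹ * b' * b⁻¹ * c * c⁻¹ = b * (b⁻¹ * a * (a'⁻¹ * b')) * b⁻¹ := by group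
      _ = 1 := by rw [heq]; group
  exact hne (h.2 j l j a ha a' ha' b' hb' b hb c hc c hc heq').1

variable [Fintype ι]

/-- **STPP ⇒ the 6-fold convolution at the identity is `∑ᵢ |Aᵢ||Bᵢ||Cᵢ|`**: with
`X = ∑ⱼ 𝟙_{Aⱼ⁻¹}𝟙_{Bⱼ}`, `Y = ∑ₗ 𝟙_{Bₗ⁻¹}𝟙_{Cₗ}`, `Z = ∑ᵢ 𝟙_{Cᵢ⁻¹}𝟙_{Aᵢ}`, `(XYZ)(1) = ∑ᵢ |Aᵢ||Bᵢ||Cᵢ|`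
(off-diagonal index triples contribute nothing by clause (ii), diagonal ones `|Aᵢ||Bᵢ||Cᵢ|` by the
triple product property of `(Aᵢ, Bᵢ, Cᵢ)`, `TripleProductProperty.coeff_one_six`).
[cite: CohnKleinbergSzegedyUmans2005, Def. 5.1] -/
theorem stpp_coeff_one_six (h : SimultaneousTPP A B C) :
    ((∑ j, indicatorElemInv R (A j) * indicatorElem R (B j)) *
        (∑ j, indicatorElemInv R (B j) * indicatorElem R (C j)) *
        (∑ j, indicatorElemInv R (C j) * indicatorElem R (A j))).coeff 1 =
      ((∑ i, (A i).card * (B i).card * (C i).card : ℕ) : R) := by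
  classical
  have hterm : ∀ j i l, ((indicatorElemInv R (A j) * indicatorElem R (B j)) *
      (indicatorElemInv R (B l) * indicatorElem R (C l)) *
      (indicatorElemInv R (C i) * indicatorElem R (A i))).coeff 1 =
        if j = l then (if i = j then (((A i).card * (B i).card * (C i).card : ℕ) : R) else 0)
        else 0 := by
    intro j i l
    by_cases hjl : j = l
    · rw [if_pos hjl]
      by_cases hij : i = j
      · rw [if_pos hij]
        subst hij hjl
        exact (h.1 _).coeff_one_six
      · rw [if_neg hij, coeff_one_six_eq_card_filter,
          stpp_filter_six_eq_empty h (fun hc => hij hc.1), Finset.card_empty, Nat.cast_zero]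
    · rw [if_neg hjl, coeff_one_six_eq_card_filter,
        stpp_filter_six_eq_empty h (fun hc => hjl hc.2), Finset.card_empty, Nat.cast_zero]
  rw [Finset.sum_mul_sum, Finset.sum_mul_sum, MonoidAlgebra.coeff_sum, Finset.sum_apply',
    Nat.cast_sum]
  refine Finset.sum_congr rfl fun j _ => ?_
  rw [MonoidAlgebra.coeff_sum, Finset.sum_apply', Finset.sum_eq_single j]
  · rw [Finset.sum_mul, MonoidAlgebra.coeff_sum, Finset.sum_apply', Finset.sum_eq_single j]
    · rw [hterm, if_pos rfl, if_pos rfl]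
    · intro l _ hlj
      rw [hterm, if_neg (Ne.symm hlj)]
    · intro hj
      exact absurd (Finset.mem_univ j) hj
  · intro i _ hij
    rw [Finset.sum_mul, MonoidAlgebra.coeff_sum, Finset.sum_apply']
    refine Finset.sum_eq_zero fun l _ => ?_
    rw [hterm, if_neg hij, ite_self]
  · intro hj
    exact absurd (Finset.mem_univ j) hj

/-- **STPP ⇒ `(X^* X)(1) = ∑ⱼ |Aⱼ||Bⱼ|`** for `X = ∑ⱼ 𝟙_{Aⱼ⁻¹}𝟙_{Bⱼ}`, `X^* = ∑ⱼ 𝟙_{Bⱼ⁻¹}𝟙_{Aⱼ}`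
(all `Cⱼ ≠ ∅`): the `ℓ²`-norm of `∑ⱼ 1_{Aⱼ⁻¹} * 1_{Bⱼ}`, the indicator function of the DISJOINT
union of the sets `Aⱼ⁻¹Bⱼ` (the input of Parseval; diagonal terms by
`TripleProductProperty.coeff_one_four`). [cite: CohnKleinbergSzegedyUmans2005, Def. 5.1] -/
theorem stpp_coeff_one_four (h : SimultaneousTPP A B C) (hC : ∀ i, (C i).Nonempty) :
    ((∑ j, indicatorElemInv R (B j) * indicatorElem R (A j)) *
        (∑ j, indicatorElemInv R (A j) * indicatorElem R (B j))).coeff 1 =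
      ((∑ i, (A i).card * (B i).card : ℕ) : R) := by
  classical
  have hterm : ∀ j l, ((indicatorElemInv R (B j) * indicatorElem R (A j)) *
      (indicatorElemInv R (A l) * indicatorElem R (B l))).coeff 1 =
        if l = j then (((A l).card * (B l).card : ℕ) : R) else 0 := by
    intro j l
    by_cases hlj : l = j
    · rw [if_pos hlj]
      subst hlj
      exact (h.1 _).coeff_one_four (hC _)
    · rw [if_neg hlj, coeff_one_four_eq_card_filter, stpp_filter_four_eq_empty h hC (Ne.symm hlj),
        Finset.card_empty, Nat.cast_zero]
  rw [Finset.sum_mul_sum, MonoidAlgebra.coeff_sum, Finset.sum_apply', Nat.cast_sum]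
  refine Finset.sum_congr rfl fun j _ => ?_
  rw [MonoidAlgebra.coeff_sum, Finset.sum_apply', Finset.sum_eq_single j]
  · rw [hterm, if_pos rfl]
  · intro l _ hlj
    rw [hterm, if_neg hlj]
  · intro hj
    exact absurd (Finset.mem_univ j) hj

end Count

/-! ## Linear characters of a perfect group -/

section Perfect

variable {G : Type} [Group G] {r : ℕ} {d : Fin r → ℕ}
  (φ : MonoidAlgebra ℂ G ≃ₐ[ℂ] BlockAlgebraC d)

/-- In a perfect group every one-dimensional block of a Wedderburn decomposition is trivial
(`g ↦ (φ g)ᵢ` is a homomorphism to the commutative group of `1 × 1` matrices, so it kills all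
commutators). [folklore] -/
theorem block_eq_one_of_dim_one (hperf : commutator G = ⊤) (i : Fin r) (hi : d i = 1) (g : G) :
    φ (MonoidAlgebra.single g 1) i = 1 := by
  haveI : Subsingleton (Fin (d i)) := by rw [hi]; infer_instance
  let ρ : G →* Matrix (Fin (d i)) (Fin (d i)) ℂ :=
    { toFun := fun g => φ (MonoidAlgebra.single g 1) i
      map_one' := by rw [← MonoidAlgebra.one_def, map_one, Pi.one_apply]
      map_mul' := fun a b => by
        rw [← Pi.mul_apply, ← map_mul, MonoidAlgebra.single_mul_single, mul_one] }
  have hcomm : ∀ M N : Matrix (Fin (d i)) (Fin (d i)) ℂ, M * N = N * M := fun M N => by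
    ext x y
    rw [Matrix.mul_apply, Matrix.mul_apply, Fintype.sum_subsingleton _ x,
      Fintype.sum_subsingleton _ x, Subsingleton.elim y x, mul_comm]
  have hker : commutator G ≤ ρ.ker := by
    rw [commutator_def]
    refine Subgroup.commutator_le.2 fun a _ b _ => ?_
    rw [MonoidHom.mem_ker, commutatorElement_def, map_mul, map_mul, map_mul, mul_assoc (ρ a),
      hcomm (ρ b), ← mul_assoc, ← map_mul, mul_inv_cancel, map_one, one_mul, ← map_mul,
      mul_inv_cancel, map_one]
  have hg : g ∈ commutator G := by rw [hperf]; exact Subgroup.mem_top g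
  exact (MonoidHom.mem_ker).1 (hker hg)

end Perfect

/-! ## The STPP form of Theorem 3.2 -/

/-- `(m • 1)ᴴ (n • 1) = (m n) • 1` for natural scalars. [folklore] -/
theorem conjTranspose_natCast_smul_one_mul {m : Type*} [Fintype m] [DecidableEq m] (a b : ℕ) :
    ((a : ℂ) • (1 : Matrix m m ℂ))ᴴ * ((b : ℂ) • (1 : Matrix m m ℂ)) = ((a * b : ℕ) : ℂ) • 1 := by
  rw [Matrix.conjTranspose_smul, Matrix.conjTranspose_one, Matrix.smul_mul, Matrix.one_mul,
    smul_smul]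
  congr 1
  simp

/-- **BCGPU 2023, Theorem 3.2 — STPP form (perfect groups).** If `G` is a finite perfect group and
the family `(Aᵢ, Bᵢ, Cᵢ)_{i ∈ ι}` of non-empty sets satisfies the simultaneous triple product
property (CKSU 2005, Def. 5.1), then with `P_AB = ∑ |Aᵢ||Bᵢ|`, `P_BC = ∑ |Bᵢ||Cᵢ|`,
`P_CA = ∑ |Cᵢ||Aᵢ|`, `N = ∑ |Aᵢ||Bᵢ||Cᵢ|` and `n(G) = secondCharDegree G`,
`P_AB P_BC P_CA ≤ |G| N + |G|^{3/2} (P_AB P_BC P_CA)^{1/2} / n(G)^{1/2}`.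
Proof: the printed proof of Thm. 3.2 with `1_{S⁻¹} * 1_T` replaced by `∑ⱼ 1_{Aⱼ⁻¹} * 1_{Bⱼ}` etc.:
Fourier inversion at `1` gives `|G| N = ∑_π d_π tr(π(X)π(Y)π(Z))`, the trivial representation
contributes `P_AB P_BC P_CA`, there is no other linear character (`G` perfect), and the blocks of
dimension `> 1` (hence `≥ n(G)`) are bounded by Cauchy–Schwarz and Parseval
(`∑ d_π ‖π(X)‖² = |G| P_AB`). For a single triple this is `BCGPU2023_thm32`.
[cite: BlasiakCohnGrochowPrattUmans2023, Thm. 3.2 (proof)] -/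
theorem BCGPU2023_thm32_stpp (G : Type) [Group G] [Fintype G] (hperf : commutator G = ⊤)
    {ι : Type*} [Fintype ι] (A B C : ι → Finset G) (hS : SimultaneousTPP A B C)
    (hA : ∀ i, (A i).Nonempty) (hB : ∀ i, (B i).Nonempty) (hC : ∀ i, (C i).Nonempty) :
    ((∑ i, (A i).card * (B i).card : ℕ) : ℝ) * ((∑ i, (B i).card * (C i).card : ℕ) : ℝ) *
        ((∑ i, (C i).card * (A i).card : ℕ) : ℝ) ≤
      (Fintype.card G : ℝ) * ((∑ i, (A i).card * (B i).card * (C i).card : ℕ) : ℝ) +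
        (Fintype.card G : ℝ) ^ (3 / 2 : ℝ) *
          Real.sqrt (((∑ i, (A i).card * (B i).card : ℕ) : ℝ) *
            ((∑ i, (B i).card * (C i).card : ℕ) : ℝ) * ((∑ i, (C i).card * (A i).card : ℕ) : ℝ)) /
          Real.sqrt (secondCharDegree G) := by
  classical
  -- a unitary Wedderburn decomposition and its trivial block
  obtain ⟨r, d, hd, φ, hφ⟩ := exists_unitary_algEquiv_pi_matrix G
  obtain ⟨i₀, hdi₀, hφi₀⟩ := exists_trivial_block φ
  -- notation
  set PAB : ℕ := ∑ i, (A i).card * (B i).card with hPAB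
  set PBC : ℕ := ∑ i, (B i).card * (C i).card with hPBC
  set PCA : ℕ := ∑ i, (C i).card * (A i).card with hPCA
  set N : ℕ := ∑ i, (A i).card * (B i).card * (C i).card with hN
  set cG : ℝ := (Fintype.card G : ℝ) with hcG
  set n : ℝ := (secondCharDegree G : ℝ) with hn
  set a : ∀ i : Fin r, ι → Matrix (Fin (d i)) (Fin (d i)) ℂ :=
    fun i j => φ (indicatorElem ℂ (A j)) i with ha
  set b : ∀ i : Fin r, ι → Matrix (Fin (d i)) (Fin (d i)) ℂ :=
    fun i j => φ (indicatorElem ℂ (B j)) i with hb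
  set c : ∀ i : Fin r, ι → Matrix (Fin (d i)) (Fin (d i)) ℂ :=
    fun i j => φ (indicatorElem ℂ (C j)) i with hc
  set X : ∀ i : Fin r, Matrix (Fin (d i)) (Fin (d i)) ℂ := fun i => ∑ j, (a i j)ᴴ * b i j with hX
  set Y : ∀ i : Fin r, Matrix (Fin (d i)) (Fin (d i)) ℂ := fun i => ∑ j, (b i j)ᴴ * c i j with hY
  set Z : ∀ i : Fin r, Matrix (Fin (d i)) (Fin (d i)) ℂ := fun i => ∑ j, (c i j)ᴴ * a i j with hZ
  -- the group-algebra elements `X = ∑ⱼ 𝟙_{Aⱼ⁻¹}𝟙_{Bⱼ}` etc. and their adjoints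
  set Xe : MonoidAlgebra ℂ G := ∑ j, indicatorElemInv ℂ (A j) * indicatorElem ℂ (B j) with hXe
  set Ye : MonoidAlgebra ℂ G := ∑ j, indicatorElemInv ℂ (B j) * indicatorElem ℂ (C j) with hYe
  set Ze : MonoidAlgebra ℂ G := ∑ j, indicatorElemInv ℂ (C j) * indicatorElem ℂ (A j) with hZe
  set Xs : MonoidAlgebra ℂ G := ∑ j, indicatorElemInv ℂ (B j) * indicatorElem ℂ (A j) with hXs
  set Ys : MonoidAlgebra ℂ G := ∑ j, indicatorElemInv ℂ (C j) * indicatorElem ℂ (B j) with hYs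
  set Zs : MonoidAlgebra ℂ G := ∑ j, indicatorElemInv ℂ (A j) * indicatorElem ℂ (C j) with hZs
  have hblock : ∀ (S T : ι → Finset G) (i : Fin r),
      φ (∑ j, indicatorElemInv ℂ (S j) * indicatorElem ℂ (T j)) i =
        ∑ j, (φ (indicatorElem ℂ (S j)) i)ᴴ * φ (indicatorElem ℂ (T j)) i := fun S T i => by
    rw [map_sum, Finset.sum_apply]
    refine Finset.sum_congr rfl fun j _ => ?_
    rw [map_mul, Pi.mul_apply, algEquiv_indicatorElemInv_eq_conjTranspose φ hφ]
  have hPX : ∀ i, φ Xe i = X i := fun i => hblock A B i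
  have hPY : ∀ i, φ Ye i = Y i := fun i => hblock B C i
  have hPZ : ∀ i, φ Ze i = Z i := fun i => hblock C A i
  have hadj : ∀ (S T : ι → Finset G) (i : Fin r),
      φ (∑ j, indicatorElemInv ℂ (T j) * indicatorElem ℂ (S j)) i =
        (φ (∑ j, indicatorElemInv ℂ (S j) * indicatorElem ℂ (T j)) i)ᴴ := fun S T i => by
    rw [hblock, hblock, Matrix.conjTranspose_sum]
    refine Finset.sum_congr rfl fun j _ => ?_
    rw [Matrix.conjTranspose_mul, Matrix.conjTranspose_conjTranspose]
  -- (1) Fourier inversion at `1` + STPP count: `|G| N = ∑ dᵢ tr(Xᵢ Yᵢ Zᵢ)`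
  have h1 : (cG * N : ℝ) = ∑ i, (d i : ℝ) * (X i * Y i * Z i).trace.re := by
    have h := card_mul_coeff_one_eq_sum_trace φ (Xe * Ye * Ze)
    rw [hXe, hYe, hZe, stpp_coeff_one_six hS] at h
    simp only [map_mul, Pi.mul_apply] at h
    rw [← hXe, ← hYe, ← hZe] at h
    simp only [hPX, hPY, hPZ] at h
    have h' := congrArg Complex.re h
    rw [Complex.re_sum] at h'
    simpa [hcG, hN] using h'
  -- (2) Parseval: `∑ dᵢ ‖Xᵢ‖² = |G| P_AB` and cyclically
  have h2X : ∑ i, (d i : ℝ) * ((X i)ᴴ * X i).trace.re = cG * PAB := by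
    have h := parseval_of_adjoint φ Xe Xs fun i => by rw [hXs, hXe, hadj A B i]
    rw [hXs, hXe, stpp_coeff_one_four hS hC] at h
    rw [← hXe] at h
    simp only [hPX] at h
    rw [hcG, hPAB]
    exact_mod_cast h
  have h2Y : ∑ i, (d i : ℝ) * ((Y i)ᴴ * Y i).trace.re = cG * PBC := by
    have h := parseval_of_adjoint φ Ye Ys fun i => by rw [hYs, hYe, hadj B C i]
    rw [hYs, hYe, stpp_coeff_one_four (simultaneousTPP_rotate hS) hA] at h
    rw [← hYe] at h
    simp only [hPY] at h
    rw [hcG, hPBC]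
    exact_mod_cast h
  have h2Z : ∑ i, (d i : ℝ) * ((Z i)ᴴ * Z i).trace.re = cG * PCA := by
    have h := parseval_of_adjoint φ Ze Zs fun i => by rw [hZs, hZe, hadj C A i]
    rw [hZs, hZe, stpp_coeff_one_four (simultaneousTPP_rotate (simultaneousTPP_rotate hS)) hB] at h
    rw [← hZe] at h
    simp only [hPZ] at h
    rw [hcG, hPCA]
    exact_mod_cast h
  -- (3) trivial blocks contribute `P = P_AB P_BC P_CA`; in a perfect group every block of
  -- dimension `1` is trivial
  set P : ℝ := (PAB : ℝ) * PBC * PCA with hP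
  have hval : ∀ i, d i = 1 → (∀ g : G, φ (MonoidAlgebra.single g 1) i = 1) →
      (d i : ℝ) * (X i * Y i * Z i).trace.re = P := by
    intro i hdi hφi
    have hind : ∀ S : Finset G, φ (indicatorElem ℂ S) i = (S.card : ℂ) • (1 : Matrix _ _ ℂ) :=
      fun S => by
      rw [indicatorElem_def, map_sum, Finset.sum_apply]
      simp only [hφi, Finset.sum_const, Nat.cast_smul_eq_nsmul]
    have hsum : ∀ S T : ι → Finset G,
        ∑ j, (φ (indicatorElem ℂ (S j)) i)ᴴ * φ (indicatorElem ℂ (T j)) i =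
          ((∑ j, (S j).card * (T j).card : ℕ) : ℂ) • (1 : Matrix _ _ ℂ) := fun S T => by
      simp only [hind, conjTranspose_natCast_smul_one_mul]
      rw [← Finset.sum_smul, Nat.cast_sum]
    have hXi : X i = (PAB : ℂ) • (1 : Matrix _ _ ℂ) := hsum A B
    have hYi : Y i = (PBC : ℂ) • (1 : Matrix _ _ ℂ) := hsum B C
    have hZi : Z i = (PCA : ℂ) • (1 : Matrix _ _ ℂ) := hsum C A
    rw [hXi, hYi, hZi]
    simp only [Matrix.smul_mul, Matrix.mul_smul, Matrix.one_mul, smul_smul, Matrix.trace_smul,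
      Matrix.trace_one, Fintype.card_fin, hdi, hP]
    simp
    ring
  have h3 : (d i₀ : ℝ) * (X i₀ * Y i₀ * Z i₀).trace.re = P := hval i₀ hdi₀ hφi₀
  have h4 : ∀ i, d i = 1 → 0 ≤ (d i : ℝ) * (X i * Y i * Z i).trace.re := by
    intro i hi
    rw [hval i hi (block_eq_one_of_dim_one φ hperf i hi), hP]
    exact mul_nonneg (mul_nonneg (Nat.cast_nonneg _) (Nat.cast_nonneg _)) (Nat.cast_nonneg _)
  -- (4) blocks of dimension `> 1`
  have hG0 : 0 ≤ cG := Nat.cast_nonneg _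
  have hAB : (0 : ℝ) ≤ PAB := Nat.cast_nonneg _
  have hBC : (0 : ℝ) ≤ PBC := Nat.cast_nonneg _
  have hCA : (0 : ℝ) ≤ PCA := Nat.cast_nonneg _
  set K : ℝ := Real.sqrt (cG * PAB / n) with hK
  have hK0 : 0 ≤ K := Real.sqrt_nonneg _
  have h5 : ∀ i, 1 < d i → (d i : ℝ) * ‖(X i * Y i * Z i).trace‖ ≤
      K * (Real.sqrt (d i * ((Y i)ᴴ * Y i).trace.re) *
        Real.sqrt (d i * ((Z i)ᴴ * Z i).trace.re)) := by
    intro i hi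
    have hdi : (0 : ℝ) < d i := by exact_mod_cast (zero_lt_one.trans hi)
    have hnle : n ≤ d i := by
      rw [hn]
      exact_mod_cast (secondCharDegree_le (blockDegree_mem_charDegrees φ i) hi).2
    have hnpos : 0 < n := by
      rw [hn]
      exact_mod_cast
        (zero_lt_two.trans_le (secondCharDegree_le (blockDegree_mem_charDegrees φ i) hi).1)
    have hXi : ((X i)ᴴ * X i).trace.re ≤ cG * PAB / n := by
      have hle : (d i : ℝ) * ((X i)ᴴ * X i).trace.re ≤ cG * PAB := by
        rw [← h2X]
        exact Finset.single_le_sum (f := fun j => (d j : ℝ) * ((X j)ᴴ * X j).trace.re)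
          (fun j _ => mul_nonneg (Nat.cast_nonneg _) (re_trace_conjTranspose_mul_self_nonneg _))
          (Finset.mem_univ i)
      calc ((X i)ᴴ * X i).trace.re ≤ cG * PAB / d i := by
            rw [le_div_iff₀ hdi, mul_comm]; exact hle
        _ ≤ cG * PAB / n := div_le_div_of_nonneg_left (mul_nonneg hG0 hAB) hnpos hnle
    calc (d i : ℝ) * ‖(X i * Y i * Z i).trace‖
        ≤ d i * (Real.sqrt (((X i)ᴴ * X i).trace.re) *
            (Real.sqrt (((Y i)ᴴ * Y i).trace.re) * Real.sqrt (((Z i)ᴴ * Z i).trace.re))) :=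
          mul_le_mul_of_nonneg_left (norm_trace_mul_mul_le _ _ _) hdi.le
      _ ≤ d i * (K * (Real.sqrt (((Y i)ᴴ * Y i).trace.re) *
            Real.sqrt (((Z i)ᴴ * Z i).trace.re))) :=
          mul_le_mul_of_nonneg_left (mul_le_mul_of_nonneg_right (Real.sqrt_le_sqrt hXi)
            (mul_nonneg (Real.sqrt_nonneg _) (Real.sqrt_nonneg _))) hdi.le
      _ = K * (Real.sqrt (d i * ((Y i)ᴴ * Y i).trace.re) *
            Real.sqrt (d i * ((Z i)ᴴ * Z i).trace.re)) := by
          rw [Real.sqrt_mul hdi.le, Real.sqrt_mul hdi.le]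
          have := Real.mul_self_sqrt hdi.le
          linear_combination
            (-(K * Real.sqrt (((Y i)ᴴ * Y i).trace.re) * Real.sqrt (((Z i)ᴴ * Z i).trace.re))) *
              this
  -- summing over the blocks of dimension `> 1`, with Cauchy–Schwarz
  have h5sum : ∑ i ∈ Finset.univ.filter (fun i => ¬ d i = 1),
      (d i : ℝ) * ‖(X i * Y i * Z i).trace‖ ≤
        K * (Real.sqrt (cG * PBC) * Real.sqrt (cG * PCA)) := by
    have hne1 : ∀ i, ¬ d i = 1 → 1 < d i := fun i hi => by
      have := (hd i).pos
      omega
    calc ∑ i ∈ Finset.univ.filter (fun i => ¬ d i = 1), (d i : ℝ) * ‖(X i * Y i * Z i).trace‖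
        ≤ ∑ i ∈ Finset.univ.filter (fun i => ¬ d i = 1),
            K * (Real.sqrt (d i * ((Y i)ᴴ * Y i).trace.re) *
              Real.sqrt (d i * ((Z i)ᴴ * Z i).trace.re)) :=
          Finset.sum_le_sum fun i hi => h5 i (hne1 i (Finset.mem_filter.1 hi).2)
      _ ≤ ∑ i, K * (Real.sqrt (d i * ((Y i)ᴴ * Y i).trace.re) *
            Real.sqrt (d i * ((Z i)ᴴ * Z i).trace.re)) :=
          Finset.sum_le_univ_sum_of_nonneg fun i =>
            mul_nonneg hK0 (mul_nonneg (Real.sqrt_nonneg _) (Real.sqrt_nonneg _))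
      _ = K * ∑ i, Real.sqrt (d i * ((Y i)ᴴ * Y i).trace.re) *
            Real.sqrt (d i * ((Z i)ᴴ * Z i).trace.re) := by
          rw [Finset.mul_sum]
      _ ≤ K * (Real.sqrt (∑ i, (d i : ℝ) * ((Y i)ᴴ * Y i).trace.re) *
            Real.sqrt (∑ i, (d i : ℝ) * ((Z i)ᴴ * Z i).trace.re)) :=
          mul_le_mul_of_nonneg_left (Real.sum_sqrt_mul_sqrt_le _
            (fun i => mul_nonneg (Nat.cast_nonneg _)
              (re_trace_conjTranspose_mul_self_nonneg _))
            (fun i => mul_nonneg (Nat.cast_nonneg _)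
              (re_trace_conjTranspose_mul_self_nonneg _))) hK0
      _ = K * (Real.sqrt (cG * PBC) * Real.sqrt (cG * PCA)) := by
          rw [h2Y, h2Z]
  -- the error term equals `|G| √|G| √P / √n`
  have hErr : K * (Real.sqrt (cG * PBC) * Real.sqrt (cG * PCA)) =
      cG * Real.sqrt cG * Real.sqrt P / Real.sqrt n := by
    rw [hK, Real.sqrt_div (mul_nonneg hG0 hAB), Real.sqrt_mul hG0, Real.sqrt_mul hG0,
      Real.sqrt_mul hG0, hP, Real.sqrt_mul (mul_nonneg hAB hBC), Real.sqrt_mul hAB]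
    have eG := Real.mul_self_sqrt hG0
    calc Real.sqrt cG * Real.sqrt PAB / Real.sqrt n *
          (Real.sqrt cG * Real.sqrt PBC * (Real.sqrt cG * Real.sqrt PCA))
        = (Real.sqrt cG * Real.sqrt cG) * Real.sqrt cG *
            (Real.sqrt PAB * Real.sqrt PBC * Real.sqrt PCA) / Real.sqrt n := by ring
      _ = cG * Real.sqrt cG * (Real.sqrt PAB * Real.sqrt PBC * Real.sqrt PCA) / Real.sqrt n := by
          rw [eG]
  -- (5) assemble: `|G| N ≥ P − |G|^{3/2} √P / √n`
  have hsplit := Finset.sum_filter_add_sum_filter_not Finset.univ (fun i => d i = 1)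
    (fun i => (d i : ℝ) * (X i * Y i * Z i).trace.re)
  have hpos : P ≤ ∑ i ∈ Finset.univ.filter (fun i => d i = 1),
      (d i : ℝ) * (X i * Y i * Z i).trace.re := by
    rw [← h3]
    exact Finset.single_le_sum (f := fun i => (d i : ℝ) * (X i * Y i * Z i).trace.re)
      (fun i hi => h4 i (Finset.mem_filter.1 hi).2) (Finset.mem_filter.2 ⟨Finset.mem_univ _, hdi₀⟩)
  have hneg : -(K * (Real.sqrt (cG * PBC) * Real.sqrt (cG * PCA))) ≤
      ∑ i ∈ Finset.univ.filter (fun i => ¬ d i = 1), (d i : ℝ) * (X i * Y i * Z i).trace.re := by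
    refine (neg_le_neg h5sum).trans ?_
    rw [← Finset.sum_neg_distrib]
    refine Finset.sum_le_sum fun i _ => ?_
    rw [← mul_neg]
    exact mul_le_mul_of_nonneg_left
      ((neg_le_neg (Complex.abs_re_le_norm _)).trans (neg_abs_le _)) (Nat.cast_nonneg _)
  have hmain : P - cG * Real.sqrt cG * Real.sqrt P / Real.sqrt n ≤ cG * N := by
    rw [h1, ← hsplit, ← hErr]
    linarith
  -- conclude
  have hGpos : (0 : ℝ) < cG := by rw [hcG]; exact_mod_cast Fintype.card_pos
  rw [rpow_three_halves hGpos]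
  linarith

/-- **Dichotomy form.** Under the hypotheses of `BCGPU2023_thm32_stpp`, with
`P = P_AB P_BC P_CA` and `N = ∑ |Aᵢ||Bᵢ||Cᵢ|`: either `P ≤ 2 |G| N` or `P ≤ 4 |G|³ / n(G)`.
(From `P ≤ |G|N + |G|^{3/2}√P/√n(G)`: if the second summand dominates then `√P ≤ 2|G|^{3/2}/√n(G)`.)
Since `N³ ≤ |G|^{3/2} P` always (pairwise packing `|Aᵢ||Cᵢ| ≤ |G|` and Cauchy–Schwarz), the first
branch gives `P ≤ 2^{3/2} |G|^{9/4}`; and `∑ᵢ (|Aᵢ||Bᵢ||Cᵢ|)^{2/3} ≤ P^{1/3}` (Hölder), so an STPP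
family in a perfect group has `∑ᵢ (|Aᵢ||Bᵢ||Cᵢ|)^{2/3} ≤ max(4^{1/3} |G| n(G)^{-1/3}, 2^{1/2}|G|^{3/4})`
— the STPP packing bound `∑ᵢ (|Aᵢ||Bᵢ||Cᵢ|)^{2/3} ≥ |G|^{1−o(1)}`, necessary for `ω = 2` through
CKSU 2005 Thm. 5.5 (`∑ᵢ(|Aᵢ||Bᵢ||Cᵢ|)^{ω/3} ≤ ∑ d_π^ω`, and `∑ d_π^w ≥ |G|` for `w ≥ 2`), fails in
every family of perfect groups with `n(G) ≥ Ω(|G|^δ)`, `δ > 0` (the STPP form of Cor. 3.3).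
[cite: BlasiakCohnGrochowPrattUmans2023, Thm. 3.2 and Cor. 3.3] -/
theorem BCGPU2023_thm32_stpp.dichotomy (G : Type) [Group G] [Fintype G] (hperf : commutator G = ⊤)
    {ι : Type*} [Fintype ι] (A B C : ι → Finset G) (hS : SimultaneousTPP A B C)
    (hA : ∀ i, (A i).Nonempty) (hB : ∀ i, (B i).Nonempty) (hC : ∀ i, (C i).Nonempty) :
    ((∑ i, (A i).card * (B i).card : ℕ) : ℝ) * ((∑ i, (B i).card * (C i).card : ℕ) : ℝ) *
          ((∑ i, (C i).card * (A i).card : ℕ) : ℝ) ≤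
        2 * (Fintype.card G : ℝ) * ((∑ i, (A i).card * (B i).card * (C i).card : ℕ) : ℝ) ∨
      ((∑ i, (A i).card * (B i).card : ℕ) : ℝ) * ((∑ i, (B i).card * (C i).card : ℕ) : ℝ) *
          ((∑ i, (C i).card * (A i).card : ℕ) : ℝ) ≤
        4 * (Fintype.card G : ℝ) ^ 3 / secondCharDegree G := by
  have h := BCGPU2023_thm32_stpp G hperf A B C hS hA hB hC
  set P : ℝ := ((∑ i, (A i).card * (B i).card : ℕ) : ℝ) * ((∑ i, (B i).card * (C i).card : ℕ) : ℝ) *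
    ((∑ i, (C i).card * (A i).card : ℕ) : ℝ) with hP
  set N : ℝ := ((∑ i, (A i).card * (B i).card * (C i).card : ℕ) : ℝ) with hN
  set cG : ℝ := (Fintype.card G : ℝ) with hcG
  set n : ℝ := (secondCharDegree G : ℝ) with hn
  have hP0 : 0 ≤ P :=
    mul_nonneg (mul_nonneg (Nat.cast_nonneg _) (Nat.cast_nonneg _)) (Nat.cast_nonneg _)
  have hG0 : 0 ≤ cG := Nat.cast_nonneg _
  have hn0 : 0 ≤ n := Nat.cast_nonneg _
  by_cases hcase : cG ^ (3 / 2 : ℝ) * Real.sqrt P / Real.sqrt n ≤ cG * N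
  · left
    linarith
  · right
    push Not at hcase
    -- `P ≤ 2 E` with `E = |G|^{3/2} √P / √n`, hence `√P ≤ 2 |G|^{3/2} / √n`
    have hE : P ≤ 2 * (cG ^ (3 / 2 : ℝ) * Real.sqrt P / Real.sqrt n) := by linarith
    by_cases hn00 : n = 0
    · rw [hn00, Real.sqrt_zero, div_zero, mul_zero] at hE
      rw [hn00, div_zero]
      exact hE
    have hnpos : 0 < n := lt_of_le_of_ne hn0 (Ne.symm hn00)
    have hsn : 0 < Real.sqrt n := Real.sqrt_pos.2 hnpos
    have hsP : Real.sqrt P * Real.sqrt P = P := Real.mul_self_sqrt hP0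
    have h2G : 0 ≤ 2 * cG ^ (3 / 2 : ℝ) / Real.sqrt n :=
      div_nonneg (mul_nonneg zero_le_two (Real.rpow_nonneg hG0 _)) (Real.sqrt_nonneg _)
    have hsqrtP : Real.sqrt P ≤ 2 * cG ^ (3 / 2 : ℝ) / Real.sqrt n := by
      by_cases hP00 : P = 0
      · rw [hP00, Real.sqrt_zero]; exact h2G
      have hsP0 : 0 < Real.sqrt P := Real.sqrt_pos.2 (lt_of_le_of_ne hP0 (Ne.symm hP00))
      have : Real.sqrt P * Real.sqrt P ≤ 2 * cG ^ (3 / 2 : ℝ) / Real.sqrt n * Real.sqrt P := by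
        rw [hsP]
        calc P ≤ 2 * (cG ^ (3 / 2 : ℝ) * Real.sqrt P / Real.sqrt n) := hE
          _ = 2 * cG ^ (3 / 2 : ℝ) / Real.sqrt n * Real.sqrt P := by ring
      exact le_of_mul_le_mul_right this hsP0
    have h32 : (cG ^ (3 / 2 : ℝ)) ^ 2 = cG ^ 3 := by
      rw [← Real.rpow_natCast, ← Real.rpow_mul hG0]
      norm_num
    calc P = Real.sqrt P * Real.sqrt P := hsP.symm
      _ ≤ (2 * cG ^ (3 / 2 : ℝ) / Real.sqrt n) * (2 * cG ^ (3 / 2 : ℝ) / Real.sqrt n) :=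
          mul_le_mul hsqrtP hsqrtP (Real.sqrt_nonneg _) h2G
      _ = 4 * (cG ^ (3 / 2 : ℝ)) ^ 2 / (Real.sqrt n * Real.sqrt n) := by ring
      _ = 4 * cG ^ 3 / n := by rw [h32, Real.mul_self_sqrt hn0]


/-! ## Packing consequences -/

/-- `∑ xᵢyᵢzᵢ ≤ √g · √(∑ xᵢyᵢ) · √(∑ yᵢzᵢ)` for non-negative reals with `zᵢxᵢ ≤ g`
(write `xyz = √(zx) · √(xy) √(yz)` and use Cauchy–Schwarz). [folklore] -/
theorem sum_mul_mul_le_sqrt {ι : Type*} (s : Finset ι) {x y z : ι → ℝ} (hx : ∀ i, 0 ≤ x i)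
    (hy : ∀ i, 0 ≤ y i) (hz : ∀ i, 0 ≤ z i) {g : ℝ} (hg : ∀ i, z i * x i ≤ g) :
    ∑ i ∈ s, x i * y i * z i ≤
      Real.sqrt g * (Real.sqrt (∑ i ∈ s, x i * y i) * Real.sqrt (∑ i ∈ s, y i * z i)) := by
  have key : ∀ i, x i * y i * z i =
      Real.sqrt (z i * x i) * (Real.sqrt (x i * y i) * Real.sqrt (y i * z i)) := by
    intro i
    rw [← Real.sqrt_mul (mul_nonneg (hx i) (hy i)), ← Real.sqrt_mul (mul_nonneg (hz i) (hx i)),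
      show z i * x i * (x i * y i * (y i * z i)) = (x i * y i * z i) * (x i * y i * z i) by ring]
    exact (Real.sqrt_mul_self (mul_nonneg (mul_nonneg (hx i) (hy i)) (hz i))).symm
  calc ∑ i ∈ s, x i * y i * z i
      = ∑ i ∈ s, Real.sqrt (z i * x i) * (Real.sqrt (x i * y i) * Real.sqrt (y i * z i)) :=
        Finset.sum_congr rfl fun i _ => key i
    _ ≤ ∑ i ∈ s, Real.sqrt g * (Real.sqrt (x i * y i) * Real.sqrt (y i * z i)) :=
        Finset.sum_le_sum fun i _ => mul_le_mul_of_nonneg_right (Real.sqrt_le_sqrt (hg i))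
          (mul_nonneg (Real.sqrt_nonneg _) (Real.sqrt_nonneg _))
    _ = Real.sqrt g * ∑ i ∈ s, Real.sqrt (x i * y i) * Real.sqrt (y i * z i) := by
        rw [Finset.mul_sum]
    _ ≤ Real.sqrt g * (Real.sqrt (∑ i ∈ s, x i * y i) * Real.sqrt (∑ i ∈ s, y i * z i)) :=
        mul_le_mul_of_nonneg_left (Real.sum_sqrt_mul_sqrt_le s (fun i => mul_nonneg (hx i) (hy i))
          (fun i => mul_nonneg (hy i) (hz i))) (Real.sqrt_nonneg _)

/-- Squared form of `sum_mul_mul_le_sqrt`: `(∑ xᵢyᵢzᵢ)² ≤ g (∑ xᵢyᵢ)(∑ yᵢzᵢ)` when `zᵢxᵢ ≤ g`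
and `0 ≤ g`. [folklore] -/
theorem sq_sum_mul_mul_le {ι : Type*} (s : Finset ι) {x y z : ι → ℝ} (hx : ∀ i, 0 ≤ x i)
    (hy : ∀ i, 0 ≤ y i) (hz : ∀ i, 0 ≤ z i) {g : ℝ} (hg0 : 0 ≤ g) (hg : ∀ i, z i * x i ≤ g) :
    (∑ i ∈ s, x i * y i * z i) ^ 2 ≤ g * (∑ i ∈ s, x i * y i) * (∑ i ∈ s, y i * z i) := by
  have h := sum_mul_mul_le_sqrt s hx hy hz hg
  have h0 : 0 ≤ ∑ i ∈ s, x i * y i * z i :=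
    Finset.sum_nonneg fun i _ => mul_nonneg (mul_nonneg (hx i) (hy i)) (hz i)
  have hxy : 0 ≤ ∑ i ∈ s, x i * y i := Finset.sum_nonneg fun i _ => mul_nonneg (hx i) (hy i)
  have hyz : 0 ≤ ∑ i ∈ s, y i * z i := Finset.sum_nonneg fun i _ => mul_nonneg (hy i) (hz i)
  calc (∑ i ∈ s, x i * y i * z i) ^ 2
      ≤ (Real.sqrt g * (Real.sqrt (∑ i ∈ s, x i * y i) * Real.sqrt (∑ i ∈ s, y i * z i))) ^ 2 :=
        pow_le_pow_left₀ h0 h 2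
    _ = g * (∑ i ∈ s, x i * y i) * (∑ i ∈ s, y i * z i) := by
        rw [mul_pow, mul_pow, Real.sq_sqrt hg0, Real.sq_sqrt hxy, Real.sq_sqrt hyz, mul_assoc]

/-- **Pairwise packing under the triple product property** (the maps `(s,t) ↦ s⁻¹t` etc. are
injective; Cohn–Umans 2003): `|A||B| ≤ |G|`, `|B||C| ≤ |G|`, `|C||A| ≤ |G|` for a TPP triple of
non-empty sets — the tree's `RealizesTPP.mul_le_card` and `TripleProductProperty.rotate`.
[cite: CohnUmans2003, Def. 2.1] -/
theorem tpp_card_mul_card_le_three {G : Type*} [Group G] [Fintype G]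
    {S T U : Finset G} (h : TripleProductProperty S T U) (hS : S.Nonempty) (hT : T.Nonempty)
    (hU : U.Nonempty) :
    S.card * T.card ≤ Fintype.card G ∧ T.card * U.card ≤ Fintype.card G ∧
      U.card * S.card ≤ Fintype.card G :=
  ⟨Literature.Computability.AlgebraicComplexity.RealizesTPP.mul_le_card
      ⟨S, T, U, rfl, rfl, rfl, h⟩ hU.card_pos.ne',
    Literature.Computability.AlgebraicComplexity.RealizesTPP.mul_le_card
      ⟨T, U, S, rfl, rfl, rfl, h.rotate⟩ hS.card_pos.ne',
    Literature.Computability.AlgebraicComplexity.RealizesTPP.mul_le_card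
      ⟨U, S, T, rfl, rfl, rfl, h.rotate.rotate⟩ hT.card_pos.ne'⟩

/-- `N⁶ ≤ |G|³ P²` for an STPP family of non-empty sets (`N = ∑|Aᵢ||Bᵢ||Cᵢ|`,
`P = P_AB P_BC P_CA`): the three inequalities `N² ≤ |G| P_AB P_BC` etc. of `sq_sum_mul_mul_le`
multiplied. Only clause (i) of the STPP (each triple has the TPP) is used. [folklore] -/
theorem stpp_sum_card_pow_six_le {G : Type*} [Group G] [Fintype G] {ι : Type*}
    [Fintype ι] {A B C : ι → Finset G} (hS : SimultaneousTPP A B C) (hA : ∀ i, (A i).Nonempty)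
    (hB : ∀ i, (B i).Nonempty) (hC : ∀ i, (C i).Nonempty) :
    ((∑ i, (A i).card * (B i).card * (C i).card : ℕ) : ℝ) ^ 6 ≤
      (Fintype.card G : ℝ) ^ 3 * (((∑ i, (A i).card * (B i).card : ℕ) : ℝ) *
        ((∑ i, (B i).card * (C i).card : ℕ) : ℝ) * ((∑ i, (C i).card * (A i).card : ℕ) : ℝ)) ^ 2 := by
  set a : ι → ℝ := fun i => ((A i).card : ℝ) with ha
  set b : ι → ℝ := fun i => ((B i).card : ℝ) with hb
  set c : ι → ℝ := fun i => ((C i).card : ℝ) with hc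
  have ha0 : ∀ i, 0 ≤ a i := fun i => Nat.cast_nonneg _
  have hb0 : ∀ i, 0 ≤ b i := fun i => Nat.cast_nonneg _
  have hc0 : ∀ i, 0 ≤ c i := fun i => Nat.cast_nonneg _
  have hG0 : (0 : ℝ) ≤ Fintype.card G := Nat.cast_nonneg _
  have hpack := fun i => tpp_card_mul_card_le_three (hS.1 i) (hA i) (hB i) (hC i)
  have hab : ∀ i, a i * b i ≤ Fintype.card G := fun i => by
    simp only [ha, hb]; exact_mod_cast (hpack i).1
  have hbc : ∀ i, b i * c i ≤ Fintype.card G := fun i => by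
    simp only [hb, hc]; exact_mod_cast (hpack i).2.1
  have hca : ∀ i, c i * a i ≤ Fintype.card G := fun i => by
    simp only [hc, ha]; exact_mod_cast (hpack i).2.2
  have hN : ((∑ i, (A i).card * (B i).card * (C i).card : ℕ) : ℝ) = ∑ i, a i * b i * c i := by
    push_cast; simp only [ha, hb, hc]
  have hPAB : ((∑ i, (A i).card * (B i).card : ℕ) : ℝ) = ∑ i, a i * b i := by
    push_cast; simp only [ha, hb]
  have hPBC : ((∑ i, (B i).card * (C i).card : ℕ) : ℝ) = ∑ i, b i * c i := by
    push_cast; simp only [hb, hc]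
  have hPCA : ((∑ i, (C i).card * (A i).card : ℕ) : ℝ) = ∑ i, c i * a i := by
    push_cast; simp only [hc, ha]
  rw [hN, hPAB, hPBC, hPCA]
  -- the three squared bounds
  have h1 : (∑ i, a i * b i * c i) ^ 2 ≤ Fintype.card G * (∑ i, a i * b i) * (∑ i, b i * c i) :=
    sq_sum_mul_mul_le _ ha0 hb0 hc0 hG0 hca
  have h2 : (∑ i, a i * b i * c i) ^ 2 ≤ Fintype.card G * (∑ i, b i * c i) * (∑ i, c i * a i) := by
    have h := sq_sum_mul_mul_le Finset.univ hb0 hc0 ha0 hG0 hab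
    have he : ∑ i, b i * c i * a i = ∑ i, a i * b i * c i :=
      Finset.sum_congr rfl fun i _ => by ring
    rwa [he] at h
  have h3 : (∑ i, a i * b i * c i) ^ 2 ≤ Fintype.card G * (∑ i, c i * a i) * (∑ i, a i * b i) := by
    have h := sq_sum_mul_mul_le Finset.univ hc0 ha0 hb0 hG0 hbc
    have he : ∑ i, c i * a i * b i = ∑ i, a i * b i * c i :=
      Finset.sum_congr rfl fun i _ => by ring
    rwa [he] at h
  have hN0 : 0 ≤ (∑ i, a i * b i * c i) ^ 2 := sq_nonneg _
  calc (∑ i, a i * b i * c i) ^ 6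
      = (∑ i, a i * b i * c i) ^ 2 * (∑ i, a i * b i * c i) ^ 2 * (∑ i, a i * b i * c i) ^ 2 := by
        ring
    _ ≤ (Fintype.card G * (∑ i, a i * b i) * (∑ i, b i * c i)) *
          (Fintype.card G * (∑ i, b i * c i) * (∑ i, c i * a i)) *
          (Fintype.card G * (∑ i, c i * a i) * (∑ i, a i * b i)) :=
        mul_le_mul (mul_le_mul h1 h2 hN0 ((sq_nonneg _).trans h1)) h3 hN0
          (mul_nonneg ((sq_nonneg _).trans h1) ((sq_nonneg _).trans h2))
    _ = (Fintype.card G : ℝ) ^ 3 *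
          ((∑ i, a i * b i) * (∑ i, b i * c i) * (∑ i, c i * a i)) ^ 2 := by ring

/-- **STPP packing dichotomy in perfect groups.** Under the hypotheses of `BCGPU2023_thm32_stpp`,
with `P = (∑|Aᵢ||Bᵢ|)(∑|Bᵢ||Cᵢ|)(∑|Cᵢ||Aᵢ|)`: `P⁴ ≤ 64 |G|⁹` or `P ≤ 4 |G|³ / n(G)`. (First branch:
`P ≤ 2|G|N` and `N⁶ ≤ |G|³P²` give `P⁶ ≤ 64|G|⁶N⁶ ≤ 64 |G|⁹ P²`.) For comparison, the "STPP packing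
bound" needed for `ω = 2` is `P ≥ |G|^{3 − o(1)}` (see `sum_rpow_two_thirds_le`).
[cite: BlasiakCohnGrochowPrattUmans2023, Thm. 3.2 and Cor. 3.3] -/
theorem BCGPU2023_thm32_stpp.packing (G : Type) [Group G] [Fintype G] (hperf : commutator G = ⊤)
    {ι : Type*} [Fintype ι] (A B C : ι → Finset G) (hS : SimultaneousTPP A B C)
    (hA : ∀ i, (A i).Nonempty) (hB : ∀ i, (B i).Nonempty) (hC : ∀ i, (C i).Nonempty) :
    (((∑ i, (A i).card * (B i).card : ℕ) : ℝ) * ((∑ i, (B i).card * (C i).card : ℕ) : ℝ) *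
          ((∑ i, (C i).card * (A i).card : ℕ) : ℝ)) ^ 4 ≤ 64 * (Fintype.card G : ℝ) ^ 9 ∨
      ((∑ i, (A i).card * (B i).card : ℕ) : ℝ) * ((∑ i, (B i).card * (C i).card : ℕ) : ℝ) *
          ((∑ i, (C i).card * (A i).card : ℕ) : ℝ) ≤
        4 * (Fintype.card G : ℝ) ^ 3 / secondCharDegree G := by
  rcases BCGPU2023_thm32_stpp.dichotomy G hperf A B C hS hA hB hC with h | h
  · left
    have h6 := stpp_sum_card_pow_six_le hS hA hB hC
    set P : ℝ := ((∑ i, (A i).card * (B i).card : ℕ) : ℝ) *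
      ((∑ i, (B i).card * (C i).card : ℕ) : ℝ) * ((∑ i, (C i).card * (A i).card : ℕ) : ℝ) with hP
    set N : ℝ := ((∑ i, (A i).card * (B i).card * (C i).card : ℕ) : ℝ) with hN
    set cG : ℝ := (Fintype.card G : ℝ) with hcG
    have hP0 : 0 ≤ P :=
      mul_nonneg (mul_nonneg (Nat.cast_nonneg _) (Nat.cast_nonneg _)) (Nat.cast_nonneg _)
    have hN0 : 0 ≤ N := Nat.cast_nonneg _
    have hG0 : 0 ≤ cG := Nat.cast_nonneg _
    -- `P⁶ ≤ (2|G|N)⁶ = 64 |G|⁶ N⁶ ≤ 64 |G|⁹ P²`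
    have hP6 : P ^ 6 ≤ 64 * cG ^ 9 * P ^ 2 :=
      calc P ^ 6 ≤ (2 * cG * N) ^ 6 := pow_le_pow_left₀ hP0 h 6
        _ = 64 * cG ^ 6 * N ^ 6 := by ring
        _ ≤ 64 * cG ^ 6 * (cG ^ 3 * P ^ 2) :=
            mul_le_mul_of_nonneg_left h6 (by positivity)
        _ = 64 * cG ^ 9 * P ^ 2 := by ring
    by_cases hP00 : P = 0
    · rw [hP00]; norm_num; positivity
    · have hP2 : 0 < P ^ 2 := pow_pos (lt_of_le_of_ne hP0 (Ne.symm hP00)) 2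
      have : P ^ 4 * P ^ 2 ≤ 64 * cG ^ 9 * P ^ 2 := by
        calc P ^ 4 * P ^ 2 = P ^ 6 := by ring
          _ ≤ 64 * cG ^ 9 * P ^ 2 := hP6
      exact le_of_mul_le_mul_right this hP2
  · right
    exact h

/-- **Hölder (AM–GM) step**: `∑ᵢ (uᵢvᵢwᵢ)^{1/3} ≤ (∑uᵢ)^{1/3}(∑vᵢ)^{1/3}(∑wᵢ)^{1/3}` for non-negative
reals (normalise and apply the weighted AM–GM inequality with weights `1/3`,
`Real.geom_mean_le_arith_mean3_weighted`). [folklore] -/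
theorem sum_rpow_third_mul_le {ι : Type*} (s : Finset ι) {u v w : ι → ℝ} (hu : ∀ i, 0 ≤ u i)
    (hv : ∀ i, 0 ≤ v i) (hw : ∀ i, 0 ≤ w i) :
    ∑ i ∈ s, (u i * v i * w i) ^ (1 / 3 : ℝ) ≤
      (∑ i ∈ s, u i) ^ (1 / 3 : ℝ) * (∑ i ∈ s, v i) ^ (1 / 3 : ℝ) * (∑ i ∈ s, w i) ^ (1 / 3 : ℝ) := by
  set U := ∑ i ∈ s, u i with hU
  set V := ∑ i ∈ s, v i with hV
  set W := ∑ i ∈ s, w i with hW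
  have hU0 : 0 ≤ U := Finset.sum_nonneg fun i _ => hu i
  have hV0 : 0 ≤ V := Finset.sum_nonneg fun i _ => hv i
  have hW0 : 0 ≤ W := Finset.sum_nonneg fun i _ => hw i
  have h3 : (1 / 3 : ℝ) ≠ 0 := by norm_num
  -- if one of the sums vanishes, both sides vanish
  have hzero : ∀ (f g h : ι → ℝ), (∀ i, 0 ≤ f i) → ∑ i ∈ s, f i = 0 →
      ∑ i ∈ s, (f i * g i * h i) ^ (1 / 3 : ℝ) = 0 := by
    intro f g h hf hf0
    have hfi : ∀ i ∈ s, f i = 0 := (Finset.sum_eq_zero_iff_of_nonneg fun i _ => hf i).1 hf0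
    exact Finset.sum_eq_zero fun i hi => by rw [hfi i hi, zero_mul, zero_mul, Real.zero_rpow h3]
  by_cases hU00 : U = 0
  · rw [hzero u v w hu (hU ▸ hU00), hU00, Real.zero_rpow h3, zero_mul, zero_mul]
  by_cases hV00 : V = 0
  · have he : ∑ i ∈ s, (u i * v i * w i) ^ (1 / 3 : ℝ) =
        ∑ i ∈ s, (v i * w i * u i) ^ (1 / 3 : ℝ) :=
      Finset.sum_congr rfl fun i _ => by rw [show u i * v i * w i = v i * w i * u i by ring]
    rw [he, hzero v w u hv (hV ▸ hV00), hV00, Real.zero_rpow h3, mul_zero, zero_mul]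
  by_cases hW00 : W = 0
  · have he : ∑ i ∈ s, (u i * v i * w i) ^ (1 / 3 : ℝ) =
        ∑ i ∈ s, (w i * u i * v i) ^ (1 / 3 : ℝ) :=
      Finset.sum_congr rfl fun i _ => by rw [show u i * v i * w i = w i * u i * v i by ring]
    rw [he, hzero w u v hw (hW ▸ hW00), hW00, Real.zero_rpow h3, mul_zero]
  have hUp : 0 < U := lt_of_le_of_ne hU0 (Ne.symm hU00)
  have hVp : 0 < V := lt_of_le_of_ne hV0 (Ne.symm hV00)
  have hWp : 0 < W := lt_of_le_of_ne hW0 (Ne.symm hW00)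
  have hU3 : 0 < U ^ (1 / 3 : ℝ) := Real.rpow_pos_of_pos hUp _
  have hV3 : 0 < V ^ (1 / 3 : ℝ) := Real.rpow_pos_of_pos hVp _
  have hW3 : 0 < W ^ (1 / 3 : ℝ) := Real.rpow_pos_of_pos hWp _
  -- termwise AM–GM on the normalised quantities
  have hterm : ∀ i, (u i * v i * w i) ^ (1 / 3 : ℝ) ≤
      U ^ (1 / 3 : ℝ) * V ^ (1 / 3 : ℝ) * W ^ (1 / 3 : ℝ) *
        ((1 / 3) * (u i / U) + (1 / 3) * (v i / V) + (1 / 3) * (w i / W)) := by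
    intro i
    have hag := Real.geom_mean_le_arith_mean3_weighted (by norm_num : (0 : ℝ) ≤ 1 / 3)
      (by norm_num : (0 : ℝ) ≤ 1 / 3) (by norm_num : (0 : ℝ) ≤ 1 / 3)
      (div_nonneg (hu i) hU0) (div_nonneg (hv i) hV0) (div_nonneg (hw i) hW0) (by norm_num)
    rw [Real.div_rpow (hu i) hU0, Real.div_rpow (hv i) hV0, Real.div_rpow (hw i) hW0] at hag
    rw [Real.mul_rpow (mul_nonneg (hu i) (hv i)) (hw i), Real.mul_rpow (hu i) (hv i)]
    calc (u i) ^ (1 / 3 : ℝ) * (v i) ^ (1 / 3 : ℝ) * (w i) ^ (1 / 3 : ℝ)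
        = U ^ (1 / 3 : ℝ) * V ^ (1 / 3 : ℝ) * W ^ (1 / 3 : ℝ) *
            ((u i) ^ (1 / 3 : ℝ) / U ^ (1 / 3 : ℝ) * ((v i) ^ (1 / 3 : ℝ) / V ^ (1 / 3 : ℝ)) *
              ((w i) ^ (1 / 3 : ℝ) / W ^ (1 / 3 : ℝ))) := by
          field_simp
        _ ≤ U ^ (1 / 3 : ℝ) * V ^ (1 / 3 : ℝ) * W ^ (1 / 3 : ℝ) *
            ((1 / 3) * (u i / U) + (1 / 3) * (v i / V) + (1 / 3) * (w i / W)) :=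
          mul_le_mul_of_nonneg_left hag (by positivity)
  calc ∑ i ∈ s, (u i * v i * w i) ^ (1 / 3 : ℝ)
      ≤ ∑ i ∈ s, U ^ (1 / 3 : ℝ) * V ^ (1 / 3 : ℝ) * W ^ (1 / 3 : ℝ) *
          ((1 / 3) * (u i / U) + (1 / 3) * (v i / V) + (1 / 3) * (w i / W)) :=
        Finset.sum_le_sum fun i _ => hterm i
    _ = U ^ (1 / 3 : ℝ) * V ^ (1 / 3 : ℝ) * W ^ (1 / 3 : ℝ) *
          ((1 / 3) * (∑ i ∈ s, u i / U) + (1 / 3) * (∑ i ∈ s, v i / V) +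
            (1 / 3) * (∑ i ∈ s, w i / W)) := by
        rw [← Finset.mul_sum, Finset.sum_add_distrib, Finset.sum_add_distrib, ← Finset.mul_sum,
          ← Finset.mul_sum, ← Finset.mul_sum]
    _ = U ^ (1 / 3 : ℝ) * V ^ (1 / 3 : ℝ) * W ^ (1 / 3 : ℝ) := by
        rw [← Finset.sum_div, ← Finset.sum_div, ← Finset.sum_div, ← hU, ← hV, ← hW,
          div_self hU00, div_self hV00, div_self hW00]
        ring

/-- **STPP packing defect in perfect quasirandom groups** (the STPP form of Cor. 3.3). Under the
hypotheses of `BCGPU2023_thm32_stpp`,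
`∑ᵢ (|Aᵢ||Bᵢ||Cᵢ|)^{2/3} ≤ max (√2 · |G|^{3/4}) (4^{1/3} |G| / n(G)^{1/3})`.
Hence in a family of perfect groups with `n(G) ≥ c|G|^δ` every STPP family has
`∑ᵢ (|Aᵢ||Bᵢ||Cᵢ|)^{2/3} ≤ C |G|^{1 − min(δ/3, 1/4)}`, whereas certifying `ω ≤ 2 + ε` through the CKSU
inequality `∑ᵢ (|Aᵢ||Bᵢ||Cᵢ|)^{ω/3} ≤ ∑_π d_π^ω` (CKSU 2005, Thm. 5.5; `∑ d_π^w ≥ ∑ d_π² = |G|` for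
`w ≥ 2`, and `|Aᵢ||Bᵢ||Cᵢ| ≤ |G|^{3/2}`) needs `∑ᵢ (|Aᵢ||Bᵢ||Cᵢ|)^{(2+ε)/3} > |G|`, i.e.
`∑ᵢ (|Aᵢ||Bᵢ||Cᵢ|)^{2/3} > |G|^{1 − ε/2}`: impossible for `ε < 2 min(δ/3, 1/4)` and `|G|` large. So
STPP constructions in perfect groups with `n(G) ≥ Ω(|G|^δ)` — e.g. `SL(n,q)`, `Sp(2n,q)`, `E₈(q)`
with the rank fixed and `q → ∞`, and all finite simple groups of Lie type of bounded rank
(Landazuri–Seitz) — cannot give `ω = 2` through CKSU Thm. 5.5 either.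
[cite: BlasiakCohnGrochowPrattUmans2023, Cor. 3.3] -/
theorem BCGPU2023_thm32_stpp.sum_rpow_two_thirds_le (G : Type) [Group G] [Fintype G]
    (hperf : commutator G = ⊤) {ι : Type*} [Fintype ι] (A B C : ι → Finset G)
    (hS : SimultaneousTPP A B C) (hA : ∀ i, (A i).Nonempty) (hB : ∀ i, (B i).Nonempty)
    (hC : ∀ i, (C i).Nonempty) :
    ∑ i, (((A i).card * (B i).card * (C i).card : ℕ) : ℝ) ^ (2 / 3 : ℝ) ≤
      max (Real.sqrt 2 * (Fintype.card G : ℝ) ^ (3 / 4 : ℝ))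
        (4 ^ (1 / 3 : ℝ) * (Fintype.card G : ℝ) / (secondCharDegree G : ℝ) ^ (1 / 3 : ℝ)) := by
  set a : ι → ℝ := fun i => ((A i).card : ℝ) with ha
  set b : ι → ℝ := fun i => ((B i).card : ℝ) with hb
  set c : ι → ℝ := fun i => ((C i).card : ℝ) with hc
  have ha0 : ∀ i, 0 ≤ a i := fun i => Nat.cast_nonneg _
  have hb0 : ∀ i, 0 ≤ b i := fun i => Nat.cast_nonneg _
  have hc0 : ∀ i, 0 ≤ c i := fun i => Nat.cast_nonneg _
  set cG : ℝ := (Fintype.card G : ℝ) with hcG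
  set n : ℝ := (secondCharDegree G : ℝ) with hn
  have hG0 : 0 ≤ cG := Nat.cast_nonneg _
  have hn0 : 0 ≤ n := Nat.cast_nonneg _
  set P : ℝ := ((∑ i, (A i).card * (B i).card : ℕ) : ℝ) *
    ((∑ i, (B i).card * (C i).card : ℕ) : ℝ) * ((∑ i, (C i).card * (A i).card : ℕ) : ℝ) with hP
  have hP0 : 0 ≤ P :=
    mul_nonneg (mul_nonneg (Nat.cast_nonneg _) (Nat.cast_nonneg _)) (Nat.cast_nonneg _)
  -- `S = ∑ (aᵢbᵢcᵢ)^{2/3} = ∑ ((aᵢbᵢ)(bᵢcᵢ)(cᵢaᵢ))^{1/3} ≤ P^{1/3}`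
  set S : ℝ := ∑ i, (((A i).card * (B i).card * (C i).card : ℕ) : ℝ) ^ (2 / 3 : ℝ) with hSdef
  have hS0 : 0 ≤ S := Finset.sum_nonneg fun i _ => Real.rpow_nonneg (Nat.cast_nonneg _) _
  have hSP : S ≤ P ^ (1 / 3 : ℝ) := by
    have h := sum_rpow_third_mul_le Finset.univ (u := fun i => a i * b i) (v := fun i => b i * c i)
      (w := fun i => c i * a i) (fun i => mul_nonneg (ha0 i) (hb0 i))
      (fun i => mul_nonneg (hb0 i) (hc0 i)) (fun i => mul_nonneg (hc0 i) (ha0 i))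
    have hPAB : ((∑ i, (A i).card * (B i).card : ℕ) : ℝ) = ∑ i, a i * b i := by
      push_cast; simp only [ha, hb]
    have hPBC : ((∑ i, (B i).card * (C i).card : ℕ) : ℝ) = ∑ i, b i * c i := by
      push_cast; simp only [hb, hc]
    have hPCA : ((∑ i, (C i).card * (A i).card : ℕ) : ℝ) = ∑ i, c i * a i := by
      push_cast; simp only [hc, ha]
    have hS' : S = ∑ i, (a i * b i * (b i * c i) * (c i * a i)) ^ (1 / 3 : ℝ) := by
      rw [hSdef]
      refine Finset.sum_congr rfl fun i _ => ?_
      have habc : 0 ≤ a i * b i * c i := mul_nonneg (mul_nonneg (ha0 i) (hb0 i)) (hc0 i)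
      rw [show a i * b i * (b i * c i) * (c i * a i) = (a i * b i * c i) ^ 2 by ring,
        ← Real.rpow_natCast, ← Real.rpow_mul habc]
      push_cast
      simp only [ha, hb, hc]
      norm_num
    rw [hS', hP, hPAB, hPBC, hPCA, Real.mul_rpow (mul_nonneg (Finset.sum_nonneg fun i _ =>
      mul_nonneg (ha0 i) (hb0 i)) (Finset.sum_nonneg fun i _ => mul_nonneg (hb0 i) (hc0 i)))
      (Finset.sum_nonneg fun i _ => mul_nonneg (hc0 i) (ha0 i)), Real.mul_rpow
      (Finset.sum_nonneg fun i _ => mul_nonneg (ha0 i) (hb0 i))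
      (Finset.sum_nonneg fun i _ => mul_nonneg (hb0 i) (hc0 i))]
    exact h
  have h13 : (0 : ℝ) < 1 / 3 := by norm_num
  rcases BCGPU2023_thm32_stpp.packing G hperf A B C hS hA hB hC with h | h
  · -- `S³ ≤ P`, `P⁴ ≤ 64|G|⁹` ⇒ `S ≤ (64 |G|⁹)^{1/12} = √2 |G|^{3/4}`
    refine le_max_of_le_left ?_
    have hP4 : P ≤ (64 * cG ^ 9) ^ (1 / 4 : ℝ) := by
      have := Real.rpow_le_rpow (pow_nonneg hP0 4) h (by norm_num : (0 : ℝ) ≤ 1 / 4)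
      rwa [← Real.rpow_natCast, ← Real.rpow_mul hP0, show ((4 : ℕ) : ℝ) * (1 / 4 : ℝ) = 1 by
        norm_num, Real.rpow_one] at this
    calc S ≤ P ^ (1 / 3 : ℝ) := hSP
      _ ≤ ((64 * cG ^ 9) ^ (1 / 4 : ℝ)) ^ (1 / 3 : ℝ) := Real.rpow_le_rpow hP0 hP4 h13.le
      _ = Real.sqrt 2 * cG ^ (3 / 4 : ℝ) := by
        rw [← Real.rpow_mul (by positivity), Real.mul_rpow (by norm_num) (by positivity),
          show (64 : ℝ) = 2 ^ (6 : ℝ) by norm_num, ← Real.rpow_mul (by norm_num),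
          ← Real.rpow_natCast cG 9, ← Real.rpow_mul hG0, Real.sqrt_eq_rpow]
        norm_num
  · -- `S³ ≤ P ≤ 4|G|³/n` ⇒ `S ≤ 4^{1/3} |G| / n^{1/3}`
    refine le_max_of_le_right ?_
    calc S ≤ P ^ (1 / 3 : ℝ) := hSP
      _ ≤ (4 * cG ^ 3 / n) ^ (1 / 3 : ℝ) := Real.rpow_le_rpow hP0 h h13.le
      _ = 4 ^ (1 / 3 : ℝ) * cG / n ^ (1 / 3 : ℝ) := by
        rw [Real.div_rpow (by positivity) hn0, Real.mul_rpow (by norm_num) (by positivity),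
          ← Real.rpow_natCast cG 3, ← Real.rpow_mul hG0]
        norm_num

end Literature.Barriers.MatrixMultiplication

end
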